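import Literature.NumberTheory.LFunctions.ConreyIwaniec2002MeanValues
import Literature.NumberTheory.LFunctions.ConreyIwaniec2002RootNumberQuotient
import Literature.NumberTheory.LFunctions.ConreyIwaniec2002MollifierMeanSquare
import Mathlib.Algebra.Order.Chebyshev
import HarnessLib

/-!
# Conrey–Iwaniec (2002), §9: the principal estimate (9.12) on one dyadic segment

Conrey–Iwaniec, *Spacing of zeros of Hecke L-functions and the class number problem*, Acta Arith.
103 (2002), §9, p. 20 [held text `paper:arxiv-math_0111012`, p0020:L45–78]. The printed derivation
of (9.12) from Proposition 9.1 (9.7) on a dyadic segment `S ⊂ (T, 2T]`: (9.10)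
`|x(s)| = 2|sin((t−t′)log t)/(t−t′)| + O(log q)` (Lemma 7.5; tree `two_mul_log_mul_sincTerm_le`),
`|x(s)| ≤ |ℓ(s)M̄(s) − x(s)| + |ℓ(s)||M(s)|` summed over the points with Cauchy's inequality (9.8)
and `Σ_s|M(s)|² ≪ T(log q)^5` (tree `sum_norm_shortInvSum_sq_le`), Proposition 9.1 for `E(T)`
(hypothesis `h1`, consumed only for `T ≥ q^65`, `log T ≥ (log q)²` — the range of its printed
proof; smaller `T` are trivial by `#S ≤ 2T`), and a cosmetic bound of the type (9.11)
(hypothesis `h4`, with a real exponent `e`: the printed claim is `e = 3`, the textbook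
`|L′(1,χ)| ≪ (log q)²` gives `e = 7/2`).

PROVED HERE (no named fact): `ConreyIwaniec2002.perSegment_algebra` (the real algebra) and
`ConreyIwaniec2002.perSegmentBound_of` (the per-segment estimate with exponent `e`). The dyadic
union and the two specialisations are in `ConreyIwaniec2002PrincipalEstimate.lean`.

## References

* [ConreyIwaniec2002] B. Conrey, H. Iwaniec, Acta Arith. 103 (2002) 259–312, arXiv:math/0111012:
  §9 (9.6)–(9.11), Proposition 9.1.
-/

noncomputable section

open scoped NumberField
open Complex

namespace Literature.NumberTheory.LFunctions

namespace ConreyIwaniec2002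

open NumberField

/-! ### The arithmetic of one dyadic segment -/

/-- **The arithmetic of (9.8)–(9.11) on one dyadic segment** (pure real algebra): from
`2(log T)Σ ≤ E + Σ|ℓ||M| + C₂ (log q) R`, Proposition 9.1 for `E`, Cauchy for `Σ|ℓ||M|`, the mean
square of `M`, `ℒ(T)^{1/2} ≤ K₄ L(1,χ)^{1/2} W` and `R ≤ 2T`, the per-segment form of (9.12) with
middle term `T (log T) L(1,χ)^{1/2} (W (log q)^{5/2})` and `C₀ = 130 + C₁ + 2C₂ + √C₃ + C₁K₄`.
[cite: ConreyIwaniec2002, §9 (9.8)–(9.11)] -/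
theorem perSegment_algebra {C₁ C₂ C₃ K₄ W T LT ℓ L1 Δ Sg E AB R cL : ℝ}
    (hC₁ : 0 < C₁) (hC₂ : 0 < C₂) (hC₃ : 0 < C₃) (hK₄ : 0 ≤ K₄) (hW : 0 ≤ W)
    (hT : 0 < T) (hLT : 0 < LT) (hℓ : 1 ≤ ℓ)
    (hsum : 2 * LT * Sg ≤ E + AB + C₂ * ℓ * R)
    (hE : E ≤ C₁ * (T * ℓ ^ (6 : ℕ) + T * Real.sqrt cL * LT ^ (2 : ℕ) * ℓ ^ ((5 : ℝ) / 2)))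
    (hCS : AB ≤ Real.sqrt Δ * Real.sqrt (C₃ * (T * ℓ ^ (5 : ℕ))))
    (hsq : Real.sqrt cL ≤ K₄ * Real.sqrt L1 * W) (hR : R ≤ 2 * T) :
    Sg ≤ (130 + C₁ + 2 * C₂ + Real.sqrt C₃ + C₁ * K₄) *
      (T / LT * ℓ ^ (6 : ℕ) + T * LT * Real.sqrt L1 * (W * ℓ ^ ((5 : ℝ) / 2)) +
        ℓ ^ ((5 : ℝ) / 2) / LT * Real.sqrt (T * Δ)) := by
  set C₀ : ℝ := 130 + C₁ + 2 * C₂ + Real.sqrt C₃ + C₁ * K₄ with hC₀def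
  have hsC₃ : 0 ≤ Real.sqrt C₃ := Real.sqrt_nonneg _
  have hC₁K₄ : 0 ≤ C₁ * K₄ := by positivity
  have hℓ0 : 0 < ℓ := by linarith
  have hℓ6 : ℓ ≤ ℓ ^ (6 : ℕ) := by
    calc ℓ = ℓ ^ 1 := (pow_one ℓ).symm
      _ ≤ ℓ ^ (6 : ℕ) := pow_le_pow_right₀ hℓ (by norm_num)
  -- algebra of square roots and half-integer powers
  have hℓ52 : Real.sqrt (ℓ ^ (5 : ℕ)) = ℓ ^ ((5 : ℝ) / 2) := by
    rw [Real.sqrt_eq_rpow, ← Real.rpow_natCast, ← Real.rpow_mul hℓ0.le]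
    norm_num
  have hsqM : Real.sqrt (C₃ * (T * ℓ ^ (5 : ℕ))) =
      Real.sqrt C₃ * ℓ ^ ((5 : ℝ) / 2) * Real.sqrt T := by
    rw [Real.sqrt_mul hC₃.le, mul_comm T, Real.sqrt_mul (by positivity), hℓ52]
    ring
  have hsqTΔ : Real.sqrt Δ * Real.sqrt T = Real.sqrt (T * Δ) := by
    rw [Real.sqrt_mul hT.le, mul_comm]
  -- the four pieces
  have hA2 : C₁ * (T * Real.sqrt cL * LT ^ (2 : ℕ) * ℓ ^ ((5 : ℝ) / 2)) ≤
      C₁ * K₄ * T * LT ^ (2 : ℕ) * Real.sqrt L1 * (W * ℓ ^ ((5 : ℝ) / 2)) := by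
    calc C₁ * (T * Real.sqrt cL * LT ^ (2 : ℕ) * ℓ ^ ((5 : ℝ) / 2))
        ≤ C₁ * (T * (K₄ * Real.sqrt L1 * W) * LT ^ (2 : ℕ) * ℓ ^ ((5 : ℝ) / 2)) := by gcongr
      _ = C₁ * K₄ * T * LT ^ (2 : ℕ) * Real.sqrt L1 * (W * ℓ ^ ((5 : ℝ) / 2)) := by ring
  have hA3 : AB ≤ Real.sqrt C₃ * ℓ ^ ((5 : ℝ) / 2) * Real.sqrt (T * Δ) := by
    calc AB ≤ Real.sqrt Δ * Real.sqrt (C₃ * (T * ℓ ^ (5 : ℕ))) := hCS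
      _ = Real.sqrt C₃ * ℓ ^ ((5 : ℝ) / 2) * (Real.sqrt Δ * Real.sqrt T) := by rw [hsqM]; ring
      _ = Real.sqrt C₃ * ℓ ^ ((5 : ℝ) / 2) * Real.sqrt (T * Δ) := by rw [hsqTΔ]
  have hA4 : C₂ * ℓ * R ≤ 2 * C₂ * T * ℓ := by
    calc C₂ * ℓ * R ≤ C₂ * ℓ * (2 * T) := by gcongr
      _ = 2 * C₂ * T * ℓ := by ring
  have hE' : E ≤ C₁ * T * ℓ ^ (6 : ℕ) +
      C₁ * K₄ * T * LT ^ (2 : ℕ) * Real.sqrt L1 * (W * ℓ ^ ((5 : ℝ) / 2)) := by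
    have h := hE
    rw [mul_add] at h
    linarith only [h, hA2]
  have hmain : 2 * LT * Sg ≤
      C₁ * T * ℓ ^ (6 : ℕ) + C₁ * K₄ * T * LT ^ (2 : ℕ) * Real.sqrt L1 * (W * ℓ ^ ((5 : ℝ) / 2)) +
        Real.sqrt C₃ * ℓ ^ ((5 : ℝ) / 2) * Real.sqrt (T * Δ) + 2 * C₂ * T * ℓ := by
    linarith only [hsum, hE', hA3, hA4]
  -- compare with `2 LT · C₀ (X₁ + X₂ + X₃)`
  have hB1 : C₁ * T * ℓ ^ (6 : ℕ) + 2 * C₂ * T * ℓ ≤ 2 * LT * (C₀ * (T / LT * ℓ ^ (6 : ℕ))) := by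
    have hEq : 2 * LT * (C₀ * (T / LT * ℓ ^ (6 : ℕ))) = 2 * C₀ * T * ℓ ^ (6 : ℕ) := by
      calc 2 * LT * (C₀ * (T / LT * ℓ ^ (6 : ℕ)))
          = 2 * C₀ * T * ℓ ^ (6 : ℕ) * (LT / LT) := by ring
        _ = 2 * C₀ * T * ℓ ^ (6 : ℕ) := by rw [div_self hLT.ne', mul_one]
    rw [hEq]
    have hC₁C₀ : C₁ ≤ C₀ := by linarith only [hC₀def, hC₂, hsC₃, hC₁K₄]
    have hC₂C₀ : 2 * C₂ ≤ C₀ := by linarith only [hC₀def, hC₁, hsC₃, hC₁K₄]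
    have h1' : C₁ * T * ℓ ^ (6 : ℕ) ≤ C₀ * T * ℓ ^ (6 : ℕ) := by gcongr
    have h2' : 2 * C₂ * T * ℓ ≤ C₀ * T * ℓ ^ (6 : ℕ) := by
      calc 2 * C₂ * T * ℓ ≤ C₀ * T * ℓ := by gcongr
        _ ≤ C₀ * T * ℓ ^ (6 : ℕ) := by gcongr
    linarith only [h1', h2']
  have hB2 : C₁ * K₄ * T * LT ^ (2 : ℕ) * Real.sqrt L1 * (W * ℓ ^ ((5 : ℝ) / 2)) ≤
      2 * LT * (C₀ * (T * LT * Real.sqrt L1 * (W * ℓ ^ ((5 : ℝ) / 2)))) := by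
    have hEq : 2 * LT * (C₀ * (T * LT * Real.sqrt L1 * (W * ℓ ^ ((5 : ℝ) / 2)))) =
        2 * C₀ * T * LT ^ (2 : ℕ) * Real.sqrt L1 * (W * ℓ ^ ((5 : ℝ) / 2)) := by ring
    rw [hEq]
    have : C₁ * K₄ ≤ 2 * C₀ := by linarith only [hC₀def, hC₁, hC₂, hsC₃, hC₁K₄]
    have hW' : 0 ≤ W * ℓ ^ ((5 : ℝ) / 2) := by positivity
    gcongr
  have hB3 : Real.sqrt C₃ * ℓ ^ ((5 : ℝ) / 2) * Real.sqrt (T * Δ) ≤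
      2 * LT * (C₀ * (ℓ ^ ((5 : ℝ) / 2) / LT * Real.sqrt (T * Δ))) := by
    have hEq : 2 * LT * (C₀ * (ℓ ^ ((5 : ℝ) / 2) / LT * Real.sqrt (T * Δ))) =
        2 * C₀ * ℓ ^ ((5 : ℝ) / 2) * Real.sqrt (T * Δ) := by
      calc 2 * LT * (C₀ * (ℓ ^ ((5 : ℝ) / 2) / LT * Real.sqrt (T * Δ)))
          = 2 * C₀ * ℓ ^ ((5 : ℝ) / 2) * Real.sqrt (T * Δ) * (LT / LT) := by ring
        _ = 2 * C₀ * ℓ ^ ((5 : ℝ) / 2) * Real.sqrt (T * Δ) := by rw [div_self hLT.ne', mul_one]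
    rw [hEq]
    have : Real.sqrt C₃ ≤ 2 * C₀ := by linarith only [hC₀def, hC₁, hC₂, hsC₃, hC₁K₄]
    gcongr
  have hfin : 2 * LT * Sg ≤ 2 * LT * (C₀ * (T / LT * ℓ ^ (6 : ℕ) +
      T * LT * Real.sqrt L1 * (W * ℓ ^ ((5 : ℝ) / 2)) +
        ℓ ^ ((5 : ℝ) / 2) / LT * Real.sqrt (T * Δ))) := by
    have h := hmain.trans (show _ ≤ 2 * LT * (C₀ * (T / LT * ℓ ^ (6 : ℕ))) +
        2 * LT * (C₀ * (T * LT * Real.sqrt L1 * (W * ℓ ^ ((5 : ℝ) / 2)))) +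
        2 * LT * (C₀ * (ℓ ^ ((5 : ℝ) / 2) / LT * Real.sqrt (T * Δ))) by
      linarith only [hB1, hB2, hB3])
    linarith only [h]
  exact le_of_mul_le_mul_left hfin (by positivity)

/-! ### (9.12) on a dyadic segment, with a real exponent `e` in the middle term -/

/-- **The per-segment principal estimate** (the printed (9.8)–(9.11) on one dyadic segment, the
trivial ranges `T < q^65 ∨ log T < (log q)²` and `(log T)L(1,χ)^{1/2}(log q)^e > 1` handled by
`#S ≤ 2T`): given Proposition 9.1 for `T ≥ q^65`, `log T ≥ (log q)²` (hypothesis `h1`) and a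
cosmetic bound `ℒ(T) ≤ C₄ L(1,χ)(log q)^{2e−5}` in the range `(log T)L(1,χ)^{1/2}(log q)^e ≤ 1`
(hypothesis `h4`), for `1`-spaced `S ⊂ (T, 2T]`, `T ≥ 2`:
`Σ_{t∈S}|sinc((t−t′)log t)| ≤ C₀(T(log q)^6/log T + T(log T)L(1,χ)^{1/2}(log q)^e + (log q)^{5/2}(TΔ)^{1/2}/log T)`.
The printed case is `e = 3`; the textbook bounds give `e = 7/2`. Lemma 7.5 and the mean square of
`M` are the tree's `two_mul_log_mul_sincTerm_le`, `sum_norm_shortInvSum_sq_le`.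
[cite: ConreyIwaniec2002, §9 (9.8)–(9.11)] -/
theorem perSegmentBound_of (e : ℝ)
    (h1 : ∃ C : ℝ, 0 < C ∧
      ∀ (q : ℕ) [NeZero q], 4 < q → Odd q → ∀ χ : DirichletCharacter ℂ q,
        χ.IsPrimitive → χ.IsQuadratic → χ.Odd →
          ∀ (K : Type) [Field K] [NumberField K],
            Module.finrank ℚ K = 2 → NumberField.discr K = -(q : ℤ) →
              ∀ (ψ : ClassGroup (𝓞 K) →* ℂˣ) (T : ℝ) (S : Finset ℝ) (t' : ℝ → ℝ),
                (q : ℝ) ^ (65 : ℕ) ≤ T → Real.exp (Real.log q ^ (2 : ℕ)) ≤ T →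
                  IsDyadicPointSet S T →
                  defectE K ψ q S t' ≤
                    C * (T * Real.log q ^ (6 : ℕ) +
                      T * Real.sqrt (calL χ T) * Real.log T ^ (2 : ℕ) * Real.log q ^ ((5 : ℝ) / 2)))
    (h4 : ∃ C : ℝ, 0 < C ∧
      ∀ (q : ℕ) [NeZero q], 4 < q → ∀ χ : DirichletCharacter ℂ q,
        χ.IsPrimitive → χ.IsQuadratic → χ.Odd → ∀ T : ℝ, 2 ≤ T →
          Real.log T * Real.sqrt ‖χ.LFunction 1‖ * Real.log q ^ e ≤ 1 →
            calL χ T ≤ C * (‖χ.LFunction 1‖ * Real.log q ^ (2 * e - 5))) :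
    ∃ C : ℝ, 0 < C ∧
    ∀ (q : ℕ) [NeZero q], 4 < q → Odd q → ∀ χ : DirichletCharacter ℂ q,
      χ.IsPrimitive → χ.IsQuadratic → χ.Odd →
        ∀ (K : Type) [Field K] [NumberField K],
          Module.finrank ℚ K = 2 → NumberField.discr K = -(q : ℤ) →
            ∀ (ψ : ClassGroup (𝓞 K) →* ℂˣ) (T : ℝ) (S : Finset ℝ) (t' : ℝ → ℝ),
              2 ≤ T → IsDyadicPointSet S T →
                ∑ t ∈ S, sincTerm t (t' t) ≤
                  C * (T / Real.log T * Real.log q ^ (6 : ℕ) +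
                    T * Real.log T * Real.sqrt ‖χ.LFunction 1‖ * Real.log q ^ e +
                    Real.log q ^ ((5 : ℝ) / 2) / Real.log T *
                      Real.sqrt (T * ∑ t ∈ S, ‖dividedDifference (classGroupLFunction K ψ)
                        (1 / 2 + t * I) (1 / 2 + t' t * I)‖ ^ 2)) := by
  classical
  obtain ⟨C₁, hC₁, h1⟩ := h1
  obtain ⟨C₂, hC₂, h2⟩ := two_mul_log_mul_sincTerm_le
  obtain ⟨C₃, hC₃, h3⟩ := sum_norm_shortInvSum_sq_le
  obtain ⟨C₄, hC₄, h4⟩ := h4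
  have hsC₃ : 0 ≤ Real.sqrt C₃ := Real.sqrt_nonneg _
  have hsC₄ : 0 ≤ Real.sqrt C₄ := Real.sqrt_nonneg _
  have hC₁C₄ : 0 ≤ C₁ * Real.sqrt C₄ := by positivity
  refine ⟨130 + C₁ + 2 * C₂ + Real.sqrt C₃ + C₁ * Real.sqrt C₄, by positivity,
    fun q _ hq hodd χ hprim hquad hoddχ K _ _ hK hdisc ψ T S t' hT hS => ?_⟩
  set C₀ : ℝ := 130 + C₁ + 2 * C₂ + Real.sqrt C₃ + C₁ * Real.sqrt C₄ with hC₀def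
  have hC₀130 : (130 : ℝ) ≤ C₀ := by linarith only [hC₀def, hC₁, hC₂, hsC₃, hC₁C₄]
  have hC₀2 : (2 : ℝ) ≤ C₀ := by linarith only [hC₀130]
  -- notation and basic positivity
  have hq5 : (5 : ℝ) ≤ q := by exact_mod_cast hq
  have hℓ1 : 1 < Real.log q := by
    rw [Real.lt_log_iff_exp_lt (by linarith)]
    exact Real.exp_one_lt_d9.trans_le (by linarith)
  set ℓ : ℝ := Real.log q with hℓdef
  have hℓ0 : 0 < ℓ := by linarith
  have hT0 : 0 < T := by linarith
  set LT : ℝ := Real.log T with hLTdef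
  have hLT0 : 0 < LT := Real.log_pos (by linarith)
  set L1 : ℝ := ‖χ.LFunction 1‖ with hL1def
  have hL1 : 0 ≤ L1 := norm_nonneg _
  set Δ : ℝ := ∑ t ∈ S, ‖dividedDifference (classGroupLFunction K ψ)
      (1 / 2 + t * I) (1 / 2 + t' t * I)‖ ^ 2 with hΔdef
  have hΔ0 : 0 ≤ Δ := Finset.sum_nonneg fun _ _ => by positivity
  have hℓe : 0 < ℓ ^ e := Real.rpow_pos_of_pos hℓ0 e
  -- the three terms of (9.12) are non-negative
  have hX₁0 : 0 ≤ T / LT * ℓ ^ (6 : ℕ) := by positivity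
  have hX₂0 : 0 ≤ T * LT * Real.sqrt L1 * ℓ ^ e := by positivity
  have hX₃0 : 0 ≤ ℓ ^ ((5 : ℝ) / 2) / LT * Real.sqrt (T * Δ) := by positivity
  -- `#S ≤ 2T` and the trivial bound `Σ ≤ #S`
  have hcard : (S.card : ℝ) ≤ 2 * T := (hS.isPointSet hT).card_le' (by linarith)
  have htriv : ∑ t ∈ S, sincTerm t (t' t) ≤ 2 * T := (sum_sincTerm_le_card S t').trans hcard
  -- Case A: the small ranges `T < q^65` or `log T < (log q)²` are trivial
  by_cases hlarge : (q : ℝ) ^ (65 : ℕ) ≤ T ∧ Real.exp (ℓ ^ (2 : ℕ)) ≤ T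
  swap
  · have hlogT : LT < 65 * ℓ ^ (6 : ℕ) := by
      rcases not_and_or.mp hlarge with h65 | hexp
      · push Not at h65
        have h := Real.log_lt_log hT0 h65
        rw [Real.log_pow, Nat.cast_ofNat] at h
        have hℓ6 : ℓ ≤ ℓ ^ (6 : ℕ) := by
          calc ℓ = ℓ ^ 1 := (pow_one ℓ).symm
            _ ≤ ℓ ^ (6 : ℕ) := pow_le_pow_right₀ hℓ1.le (by norm_num)
        calc LT < 65 * ℓ := h
          _ ≤ 65 * ℓ ^ (6 : ℕ) := by gcongr
      · push Not at hexp
        have h := Real.log_lt_log hT0 hexp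
        rw [Real.log_exp] at h
        have hℓ26 : ℓ ^ (2 : ℕ) ≤ ℓ ^ (6 : ℕ) := pow_le_pow_right₀ hℓ1.le (by norm_num)
        have hℓ60 : 0 ≤ ℓ ^ (6 : ℕ) := by positivity
        linarith only [h, hℓ26, hℓ60]
    have hkey : 2 * T ≤ C₀ * (T / LT * ℓ ^ (6 : ℕ)) := by
      rw [show C₀ * (T / LT * ℓ ^ (6 : ℕ)) = (C₀ * T * ℓ ^ (6 : ℕ)) / LT by ring,
        le_div_iff₀ hLT0]
      calc 2 * T * LT ≤ 2 * T * (65 * ℓ ^ (6 : ℕ)) := by gcongr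
        _ = 130 * T * ℓ ^ (6 : ℕ) := by ring
        _ ≤ C₀ * T * ℓ ^ (6 : ℕ) := by gcongr
    calc ∑ t ∈ S, sincTerm t (t' t) ≤ 2 * T := htriv
      _ ≤ C₀ * (T / LT * ℓ ^ (6 : ℕ)) := hkey
      _ ≤ C₀ * (T / LT * ℓ ^ (6 : ℕ) + T * LT * Real.sqrt L1 * ℓ ^ e +
            ℓ ^ ((5 : ℝ) / 2) / LT * Real.sqrt (T * Δ)) := by
          gcongr; linarith only [hX₂0, hX₃0]
  -- Case B1: the range `(log T) L(1,χ)^{1/2} (log q)^e > 1` is trivial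
  by_cases hsmall : LT * Real.sqrt L1 * ℓ ^ e ≤ 1
  swap
  · push Not at hsmall
    have hkey : 2 * T ≤ C₀ * (T * LT * Real.sqrt L1 * ℓ ^ e) := by
      calc 2 * T = 2 * T * 1 := by ring
        _ ≤ C₀ * T * (LT * Real.sqrt L1 * ℓ ^ e) := by gcongr
        _ = C₀ * (T * LT * Real.sqrt L1 * ℓ ^ e) := by ring
    calc ∑ t ∈ S, sincTerm t (t' t) ≤ 2 * T := htriv
      _ ≤ C₀ * (T * LT * Real.sqrt L1 * ℓ ^ e) := hkey
      _ ≤ C₀ * (T / LT * ℓ ^ (6 : ℕ) + T * LT * Real.sqrt L1 * ℓ ^ e +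
            ℓ ^ ((5 : ℝ) / 2) / LT * Real.sqrt (T * Δ)) := by
          gcongr; linarith only [hX₁0, hX₃0]
  -- Case B2: the genuine case — per point `2 log T · sinc ≤ |ℓM̄ − x| + |ℓ||M| + C₂ ℓ`
  have hpt : ∀ t ∈ S, 2 * LT * sincTerm t (t' t) ≤
      ‖dividedDifference (classGroupLFunction K ψ) (1 / 2 + t * I) (1 / 2 + t' t * I) *
          starRingEnd ℂ (shortInvSum K ψ q (1 / 2 + t * I)) -
          xQuot q (1 / 2 + t * I) (1 / 2 + t' t * I)‖ +
        ‖dividedDifference (classGroupLFunction K ψ) (1 / 2 + t * I) (1 / 2 + t' t * I)‖ *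
          ‖shortInvSum K ψ q (1 / 2 + t * I)‖ + C₂ * ℓ := by
    intro t ht
    have hTt : T < t := (hS.mem_bounds ht).1
    have hlogt : LT ≤ Real.log t := Real.log_le_log hT0 hTt.le
    have h75 := h2 q hq t (t' t) (by linarith)
    have htri := norm_sub_le
      (dividedDifference (classGroupLFunction K ψ) (1 / 2 + t * I) (1 / 2 + t' t * I) *
        starRingEnd ℂ (shortInvSum K ψ q (1 / 2 + t * I)))
      (dividedDifference (classGroupLFunction K ψ) (1 / 2 + t * I) (1 / 2 + t' t * I) *
        starRingEnd ℂ (shortInvSum K ψ q (1 / 2 + t * I)) -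
        xQuot q (1 / 2 + t * I) (1 / 2 + t' t * I))
    rw [sub_sub_cancel, norm_mul, Complex.norm_conj] at htri
    have hmono : 2 * LT * sincTerm t (t' t) ≤ 2 * Real.log t * sincTerm t (t' t) := by
      have := sincTerm_nonneg t (t' t)
      gcongr
    linarith only [h75, htri, hmono]
  -- sum over the points
  have hsum : 2 * LT * ∑ t ∈ S, sincTerm t (t' t) ≤ defectE K ψ q S t' +
      ∑ t ∈ S, ‖dividedDifference (classGroupLFunction K ψ) (1 / 2 + t * I) (1 / 2 + t' t * I)‖ *
        ‖shortInvSum K ψ q (1 / 2 + t * I)‖ + C₂ * ℓ * S.card := by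
    rw [Finset.mul_sum]
    refine (Finset.sum_le_sum hpt).trans (le_of_eq ?_)
    rw [Finset.sum_add_distrib, Finset.sum_add_distrib, Finset.sum_const, nsmul_eq_mul]
    unfold defectE
    ring
  -- Proposition 9.1, the mean square of `M`, Cauchy's inequality, (9.11)
  have hE := h1 q hq hodd χ hprim hquad hoddχ K hK hdisc ψ T S t' hlarge.1 hlarge.2 hS
  have hq4T : (q : ℝ) ^ (4 : ℕ) ≤ T :=
    le_trans (pow_le_pow_right₀ (by linarith) (by norm_num)) hlarge.1
  have hM := h3 q hq hodd χ hprim hquad hoddχ K hK hdisc ψ T S hq4T hS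
  have hCS : ∑ t ∈ S, ‖dividedDifference (classGroupLFunction K ψ) (1 / 2 + t * I)
      (1 / 2 + t' t * I)‖ * ‖shortInvSum K ψ q (1 / 2 + t * I)‖ ≤
      Real.sqrt Δ * Real.sqrt (C₃ * (T * ℓ ^ (5 : ℕ))) := by
    have hcs := Finset.sum_mul_sq_le_sq_mul_sq S
      (fun t => ‖dividedDifference (classGroupLFunction K ψ) (1 / 2 + t * I) (1 / 2 + t' t * I)‖)
      (fun t => ‖shortInvSum K ψ q (1 / 2 + t * I)‖)
    have h1' := (le_abs_self _).trans (Real.abs_le_sqrt hcs)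
    rw [Real.sqrt_mul (Finset.sum_nonneg fun _ _ => by positivity)] at h1'
    refine h1'.trans ?_
    gcongr
  have hcalL : calL χ T ≤ C₄ * (L1 * ℓ ^ (2 * e - 5)) := h4 q hq χ hprim hquad hoddχ T hT hsmall
  -- `√ℒ ≤ √C₄ √L1 ℓ^{e − 5/2}`
  have hsq : Real.sqrt (calL χ T) ≤ Real.sqrt C₄ * Real.sqrt L1 * ℓ ^ (e - 5 / 2) := by
    have hW : Real.sqrt (ℓ ^ (2 * e - 5)) = ℓ ^ (e - 5 / 2) := by
      rw [Real.sqrt_eq_rpow, ← Real.rpow_mul hℓ0.le]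
      congr 1
      ring
    rw [← hW, ← Real.sqrt_mul hC₄.le, ← Real.sqrt_mul (by positivity)]
    exact Real.sqrt_le_sqrt (by nlinarith [hcalL])
  have halg := perSegment_algebra hC₁ hC₂ hC₃ hsC₄ (Real.rpow_nonneg hℓ0.le _) hT0 hLT0 hℓ1.le
    hsum hE hCS hsq hcard
  -- `ℓ^{e−5/2} ℓ^{5/2} = ℓ^e`
  have hℓpow : ℓ ^ (e - 5 / 2) * ℓ ^ ((5 : ℝ) / 2) = ℓ ^ e := by
    rw [← Real.rpow_add hℓ0]
    congr 1
    ring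
  rw [hℓpow] at halg
  exact halg

end ConreyIwaniec2002

end Literature.NumberTheory.LFunctions

end
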